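import Literature.NumberTheory.Rogawski1990.ArchStableOrbitalWallClassRegrouping   -- (D2-comb) (this seat): weighted class regrouping ⇒ `(∏ Λ_v) · Φ^st_∞(t z, e·a)`
import Literature.NumberTheory.Rogawski1990.ArchStableOrbitalWallCoefficients     -- (D2-eval) (this seat): the per-place fibre sums `= −2M_v·p!(3−p)!·e`
import HarnessLib

/-!
# THE SIGNED END STATE OF THE «METHOD OF §8.2» ON ONE DIAGONAL CARRIER: `Σ_ρ (Π_v κ_v(ρ_v))·K⁻¹·I(ρ) = (Π_v (−2M_v)) · Φ^st_∞(t z⁰, (e_∞∘⟦·⟧)·a)`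
# ((R1-h-d) (D3), algebraic assembly over (D2-comb) + (D2-eval); Rogawski 1990 §8.2 p. 124 «a non-zero constant times `Φ^st(γ₀, f)`», §4.1 (4.1.2))

Topic `NumberTheory/Rogawski1990`; namespace `Literature.NumberTheory.Rogawski1990`.  THEOREMS ONLY (no `def`, no instance, no notation, no axiom, no named fact, no `sorry`).
Cell `pub/hodgecm-mathlib`, ENGINE T1 (crux H413 = `stmt-HodgeConjecture-24833`); floor-2 road «(J-nc) in-house», brick (D3) of (R1-h-d) (LEAD F0P3a-plan (g9) WORD T8-119∕T8-120;
F0P3-p03 (g9) «=» 07:08:40Z); author F0P3a-p07 (g8), 2026-09-01.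

WHAT.  One side of ★-to-be (D0-3) `wallCoef_sum_prod_mul_eq_of_regular_eq_of_clause` is `Σ_{ρ : W → S₃} (∏_v κ_v(ρ_v)) · (K_α⁻¹ · I(ρ))` with `κ_v(σ) = (cw_v σ ? 2 : c v σ⁻¹)`,
`K_α = ∏_v p_v!(3−p_v)!` and `I(ρ) = ∫ Θ ↑↑(e⁻¹ o) d(⊗_v Wm_v(ρ_v))`.  The per-`ρ` reading (★-to-be (P1) `integral_pi_wallFactor_eq_prod_smul_classOrbitalIntegral`) gives
`I(ρ) = (∏_v λ_v(ρ_v)) • Φ(⟦t(z⁰∘ρ)⟧, a; m)` with `λ_v(σ) = (cw_v σ ? mass_v σ : 1) ∈ ℝ≥0`; it enters here as the HYPOTHESIS `hI` (so this file is pure algebra).  With the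
ANALYTIC inputs `hC : ¬cw_v σ → c v σ⁻¹ = −M_v` (one noncompact constant per place, ★-to-be (D2-coef) `const_eq_of_wallLinks` + the VALUE (J-val)) and `hM : cw_v σ → mass_v σ = M_v`
(one compact mass per place), (D2-eval) evaluates every per-place fibre sum of `κ_v·λ_v` as `−2M_v·p_v!(3−p_v)! · e_v`, and (D2-comb) regroups:
**`sum_prod_wallCoef_mul_eq_prod_mul_archStableOrbitalIntegral`**:
`Σ_ρ (∏_v κ_v(ρ_v)) · (K_α⁻¹ · I(ρ)) = (∏_v (−2·M_v)) · Φ^st_∞(t z⁰, (e_∞∘⟦·⟧)·a)` — print's «equal to a non-zero constant times `Φ^st(γ₀, f)`» with the constant EXPLICIT and the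
SAME expression on both inner forms (so that equal regular data ⇒ `(∏ −2M_v)·Φ^{st,e} = (∏ −2M′_v)·Φ′^{st,e}`).
HONEST LABEL: HC_CM is proved only modulo the 7 printed citations until rung 0 closes; this file is algebra over ★ bricks and pays nothing by itself.

## References
* [Rogawski1990] J. D. Rogawski, *Automorphic Representations of Unitary Groups in Three Variables*, Ann. of Math. Stud. 123 (1990), §8.2 pp. 122–124, §14.5 pp. 238–239, §4.1 (4.1.2).
* [BrockerTomDieck1985] Th. Bröcker, T. tom Dieck, *Representations of Compact Lie Groups*, GTM 98 (1985), IV (3.2).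
-/

set_option autoImplicit false

noncomputable section

open Matrix Equiv Finset NumberField NumberField.InfinitePlace
open Literature.LinearAlgebra.Matrix Literature.NumberTheory.Automorphic Literature.NumberTheory.Automorphic.UnitaryGroup
open scoped MatrixGroups ComplexConjugate NNReal

namespace Literature.NumberTheory.Rogawski1990

variable (L : Type) [Field L] [NumberField L] [IsCMField L] (α : Fin 3 → L)
  [∀ g : ↥(arch (↥(maximalRealSubfield L)) L (IsCMField.complexConj L) 3 (diagonal α)),
    MeasurableSpace (↥(arch (↥(maximalRealSubfield L)) L (IsCMField.complexConj L) 3 (diagonal α)) ⧸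
      Subgroup.centralizer ({g} : Set ↥(arch (↥(maximalRealSubfield L)) L (IsCMField.complexConj L) 3 (diagonal α))))]

open scoped Classical in
/-- **(R1-h-d) THE SIGNED END STATE ON ONE DIAGONAL CARRIER.**  Hypotheses: `hα`, `hherm` (real non-zero weights), the wall point `z⁰` (`z⁰_v 0 = z⁰_v 2 ≠ z⁰_v 1`), the per-`ρ`
reading `hI` of the end-state integrals as multiples of class orbital integrals (★ (P1)), one noncompact constant `−M_v` (`hC`) and one compact mass `M_v` (`hM`) per place.  Conclusion:
`Σ_ρ (∏_v (cw ? 2 : c v (ρ v)⁻¹)) · ((∏_v p_v!(3−p_v)!)⁻¹ · I ρ) = (∏_v (−2·M_v)) · archStableOrbitalIntegral … m (fun x => e_∞ ⟦x⟧ · a x) (t z⁰)`.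
[cite: Rogawski1990, §8.2 p. 124; §14.5 p. 238–239; §4.1 (4.1.2) p. 39] -/
theorem sum_prod_wallCoef_mul_eq_prod_mul_archStableOrbitalIntegral
    (hα : ∀ i, α i ≠ 0) (hherm : ∀ i, (IsCMField.complexConj L (α i) : L) = α i)
    (z0 : {w : InfinitePlace L // IsComplex w} → Fin 3 → Circle) (hwall : ∀ v, z0 v 0 = z0 v 2 ∧ z0 v 0 ≠ z0 v 1)
    (c : {w : InfinitePlace L // IsComplex w} → Perm (Fin 3) → ℂ) (mass : {w : InfinitePlace L // IsComplex w} → Perm (Fin 3) → ℝ≥0)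
    (M : {w : InfinitePlace L // IsComplex w} → ℝ)
    (hC : ∀ (v : {w : InfinitePlace L // IsComplex w}) (σ : Perm (Fin 3)),
      ¬ 0 < (v.1.embedding (α (σ⁻¹ 0))).re * (v.1.embedding (α (σ⁻¹ 2))).re → c v σ⁻¹ = -(M v : ℂ))
    (hM : ∀ (v : {w : InfinitePlace L // IsComplex w}) (σ : Perm (Fin 3)),
      0 < (v.1.embedding (α (σ⁻¹ 0))).re * (v.1.embedding (α (σ⁻¹ 2))).re → ((mass v σ : ℝ≥0) : ℝ) = M v)
    (m : OrbitalMeasureFamily ↥(arch (↥(maximalRealSubfield L)) L (IsCMField.complexConj L) 3 (diagonal α)))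
    (a : ↥(arch (↥(maximalRealSubfield L)) L (IsCMField.complexConj L) 3 (diagonal α)) → ℂ)
    (I : ({w : InfinitePlace L // IsComplex w} → Perm (Fin 3)) → ℂ)
    (hI : ∀ ρ : {w : InfinitePlace L // IsComplex w} → Perm (Fin 3),
      I ρ = ((∏ v : {w : InfinitePlace L // IsComplex w}, (if 0 < (v.1.embedding (α ((ρ v)⁻¹ 0))).re * (v.1.embedding (α ((ρ v)⁻¹ 2))).re then mass v (ρ v) else 1 : ℝ≥0) : ℝ≥0) : ℝ) •
        classOrbitalIntegral m a (ConjClasses.mk (archDiagTorus L 3 α fun w => z0 w ∘ ⇑(ρ w)))) :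
    ∑ ρ : {w : InfinitePlace L // IsComplex w} → Perm (Fin 3),
        (∏ v, (if 0 < (v.1.embedding (α ((ρ v)⁻¹ 0))).re * (v.1.embedding (α ((ρ v)⁻¹ 2))).re then (2 : ℂ) else c v (ρ v)⁻¹)) *
          ((((∏ v : {w : InfinitePlace L // IsComplex w},
            (Finset.univ.filter fun i => 0 < (v.1.embedding (α i)).re).card.factorial *
              (3 - (Finset.univ.filter fun i => 0 < (v.1.embedding (α i)).re).card).factorial : ℕ) : ℂ)⁻¹ * I ρ)) =
      (∏ v : {w : InfinitePlace L // IsComplex w}, (-(2 : ℂ) * M v)) *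
        archStableOrbitalIntegral L 3 (diagonal α) m (fun x => kottwitzSignArchWeight L 3 (diagonal α) (ConjClasses.mk x) * a x) (archDiagTorus L 3 α z0) := by
  have hreal : ∀ (v : {w : InfinitePlace L // IsComplex w}) (i : Fin 3), (v.1.embedding (α i)).im = 0 :=
    fun v i => im_embedding_eq_zero_of_complexConj_eq L v (hherm i)
  have hKne : ∀ v : {w : InfinitePlace L // IsComplex w}, (((Finset.univ.filter fun i => 0 < (v.1.embedding (α i)).re).card.factorial *
      (3 - (Finset.univ.filter fun i => 0 < (v.1.embedding (α i)).re).card).factorial : ℕ) : ℂ) ≠ 0 := fun v => by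
    exact_mod_cast (Nat.mul_ne_zero (Nat.factorial_ne_zero _) (Nat.factorial_ne_zero _))
  -- the weights `wt_v(σ) = κ_v(σ) · λ_v(σ)`, regrouped by (D2-comb) with the coefficients of (D2-eval)
  have hsum := sum_univ_prod_mul_classOrbitalIntegral_mk_archDiagTorus_comp_eq_prod_mul_archStableOrbitalIntegral L 3 α hα hherm z0
    (fun v σ => (if 0 < (v.1.embedding (α (σ⁻¹ 0))).re * (v.1.embedding (α (σ⁻¹ 2))).re then (2 : ℂ) else c v σ⁻¹) *
      (((if 0 < (v.1.embedding (α (σ⁻¹ 0))).re * (v.1.embedding (α (σ⁻¹ 2))).re then mass v σ else 1 : ℝ≥0) : ℝ) : ℂ))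
    (fun v => -(2 : ℂ) * M v * ((Finset.univ.filter fun i => 0 < (v.1.embedding (α i)).re).card.factorial *
      (3 - (Finset.univ.filter fun i => 0 < (v.1.embedding (α i)).re).card).factorial : ℕ))
    (fun v r => sum_filter_wallWeight_eq_neg_two_mul_mul_kottwitzSign L α v hα (hreal v) (hwall v).1 (hwall v).2 (fun σ => c v σ⁻¹) (mass v) (M v)
      (hC v) (hM v) r)
    m a
  -- each summand through `hI`
  have hterm : ∀ ρ : {w : InfinitePlace L // IsComplex w} → Perm (Fin 3),
      (∏ v, (if 0 < (v.1.embedding (α ((ρ v)⁻¹ 0))).re * (v.1.embedding (α ((ρ v)⁻¹ 2))).re then (2 : ℂ) else c v (ρ v)⁻¹)) *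
          ((((∏ v : {w : InfinitePlace L // IsComplex w},
            (Finset.univ.filter fun i => 0 < (v.1.embedding (α i)).re).card.factorial *
              (3 - (Finset.univ.filter fun i => 0 < (v.1.embedding (α i)).re).card).factorial : ℕ) : ℂ)⁻¹ * I ρ)) =
        (((∏ v : {w : InfinitePlace L // IsComplex w},
            (Finset.univ.filter fun i => 0 < (v.1.embedding (α i)).re).card.factorial *
              (3 - (Finset.univ.filter fun i => 0 < (v.1.embedding (α i)).re).card).factorial : ℕ) : ℂ)⁻¹ *
          ((∏ v, ((if 0 < (v.1.embedding (α ((ρ v)⁻¹ 0))).re * (v.1.embedding (α ((ρ v)⁻¹ 2))).re then (2 : ℂ) else c v (ρ v)⁻¹) *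
            (((if 0 < (v.1.embedding (α ((ρ v)⁻¹ 0))).re * (v.1.embedding (α ((ρ v)⁻¹ 2))).re then mass v (ρ v) else 1 : ℝ≥0) : ℝ) : ℂ))) *
            classOrbitalIntegral m a (ConjClasses.mk (archDiagTorus L 3 α fun w => z0 w ∘ ⇑(ρ w))))) := by
    intro ρ
    rw [hI ρ, Complex.real_smul, NNReal.coe_prod, Complex.ofReal_prod,
      prod_mul_distrib (f := fun v : {w : InfinitePlace L // IsComplex w} =>
        (if 0 < (v.1.embedding (α ((ρ v)⁻¹ 0))).re * (v.1.embedding (α ((ρ v)⁻¹ 2))).re then (2 : ℂ) else c v (ρ v)⁻¹))]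
    ring
  rw [Finset.sum_congr rfl fun ρ _ => hterm ρ, ← Finset.mul_sum, hsum, ← mul_assoc]
  congr 1
  rw [prod_mul_distrib (f := fun v : {w : InfinitePlace L // IsComplex w} => -(2 : ℂ) * M v), Nat.cast_prod]
  have hKprod : (∏ v : {w : InfinitePlace L // IsComplex w}, (((Finset.univ.filter fun i => 0 < (v.1.embedding (α i)).re).card.factorial *
      (3 - (Finset.univ.filter fun i => 0 < (v.1.embedding (α i)).re).card).factorial : ℕ) : ℂ)) ≠ 0 :=
    prod_ne_zero_iff.mpr fun v _ => hKne v
  rw [mul_comm (∏ v : {w : InfinitePlace L // IsComplex w}, (-(2 : ℂ) * M v)), ← mul_assoc, inv_mul_cancel₀ hKprod, one_mul]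

end Literature.NumberTheory.Rogawski1990

end
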